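import Summits.BirchSwinnertonDyer.BirchSwinnertonDyer.Theorems.GenusKolyvaginAtTwoTorsionCellD0TripleTwistKernel
import HarnessLib

/-!
# D0≤2, one genus step: a Selmer class of `E₀^{(−p₀q₁q₂)}` unramified at the three twisting primes is trivial

Crux R″ `RankOneTwoTorsionResidualAtTwo` (stmt-27478), LINE 49 «full_vertex», stub D0≤2
`FullTorsionGenusSelmerLawUpToTwoAtTwo`, slice `#Q₀ = 2`, the twist `C₁ = E₀^{(−p₀M₀)}`, `M₀ = q₁q₂` (setting of
`…D0TripleTwistKernel`: `E/ℚ` with rational `2`-torsion, rank `0`, `Ш(E)[2] = 0`, good reduction off `S ∋ 2`; distinct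
primes `p, q₁, q₂ ∉ S`, `p ≡ 7 (mod 8)`, `qᵢ ≡ 3 (mod 4)`, `q₁q₂ ≡ 1 (mod 8)`, `(−p/ℓ) = (q₁q₂/ℓ) = 1` for odd `ℓ ∈ S`,
`δ₁, δ₂` non-residues at `q₁`).

* **`eq_zero_of_mem_selmerGroup_twist_triple`**: a class of `Sel⁽²⁾(E^{(−pq₁q₂)}/ℚ)` whose components have even
  valuation at `p`, `q₁` and `q₂` is `0` — the kernel of the parity map `N_p → (ℤ/2)⁴` at `q₁, q₂` is trivial, the
  injectivity half of `#Sel⁽²⁾(C₁) ≤ 8`. Its components are positive (`I₀*` at `p` and (R2)); the same-component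
  class of `E` is Selmer (transfer at `S`, where `−pq₁q₂` is a square; `S`-supported integer kernels elsewhere;
  positivity at `∞`) with vanishing `q₁`-residues (`I₀*` at `q₁`), hence `0` by the residue-kernel lemma.

Everything is proved; no LINE 49 statement is restated; BSD is not advanced by this file alone.

## References

* [SilvermanAEC2009] J. H. Silverman, *The Arithmetic of Elliptic Curves*, 2nd ed., GTM 106, Springer 2009,
  Prop. X.1.4, Thm. X.4.2, Prop. X.4.9.
* [Kramer1981] K. Kramer, *Arithmetic of elliptic curves upon quadratic extension*, Trans. AMS 264 (1981), Thm. 1.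
-/

noncomputable section

open scoped Classical

namespace Summit.BirchSwinnertonDyer.BirchSwinnertonDyer.Theorems.GenusKolyvaginAtTwo.TorsionCellD0

open WeierstrassCurve WeierstrassCurve.Affine WeierstrassCurve.Affine.Point
open Literature.NumberTheory.GaloisRepresentations Literature.NumberTheory.EllipticCurves Field
open Literature.NumberTheory.EllipticCurves.TwoDescentLocal
open Literature.NumberTheory.EllipticCurves.KramerTwoDescent
open IsDedekindDomain NumberField Rat.HeightOneSpectrum

variable (E : WeierstrassCurve ℚ) [E.IsElliptic] {e₁ e₂ e₃ : ℚ}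
variable (S : Finset ℕ) {p q₁ q₂ : ℕ} [hp : Fact p.Prime] [hq₁ : Fact q₁.Prime] [hq₂ : Fact q₂.Prime]

section Unramified

/-- **A Selmer class of `E^{(−pq₁q₂)}` unramified at `p`, `q₁`, `q₂` is `0`** (setting of the module docstring, base
`E` of rank `0` with `Ш(E)[2] = 0` and good reduction off `S`; `δ₁ = (e₁-e₂)(e₁-e₃)`, `δ₂ = (e₂-e₁)(e₂-e₃)` non-residues
at `q₁`): if `c ∈ Sel⁽²⁾(E^{(d)}/ℚ)` has components `([a],[b])` with `v_p, v_{q₁}, v_{q₂}` of `a` and `b` all even,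
then `c = 0`. Proof: the `I₀*` relations at `p` and (R2) make `a, b > 0`; the same-component class of `E` is Selmer
(transfer at `S`, where `d` is a square; `S`-supported integer kernels elsewhere; positivity at `∞`); its
`q₁`-residues vanish by the `I₀*` relations at `q₁`, so it is `0` by the residue-kernel lemma, whence `[a] = [b] = 1`.
[cite: SilvermanAEC2009, Prop. X.1.4, Thm. X.4.2, Prop. X.4.9] [cite: Kramer1981, Thm. 1] -/
theorem eq_zero_of_mem_selmerGroup_twist_triple (h : E.toAffine.SplitTwoTorsion e₁ e₂ e₃) (hS : ∀ q ∈ S, q.Prime)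
    (h2S : 2 ∈ S)
    (hgood : ∀ ℓ : ℕ, (hℓ : ℓ.Prime) → ℓ ∉ S → haveI : Fact ℓ.Prime := ⟨hℓ⟩;
      padicValRat ℓ (e₁ - e₂) = 0 ∧ padicValRat ℓ (e₁ - e₃) = 0 ∧ padicValRat ℓ (e₂ - e₃) = 0)
    (hN : ∀ ℓ : ℕ, ℓ.Prime → ℓ ∉ S → ¬ ℓ ∣ E.conductorNorm ℤ)
    (hrank : E.mordellWeilRank = 0) (hsha : ∀ x ∈ E.sha, (2 : ℕ) • x = 0 → x = 0)
    (hpS : p ∉ S) (hq₁S : q₁ ∉ S) (hq₂S : q₂ ∉ S) (hpq₁ : p ≠ q₁) (hpq₂ : p ≠ q₂) (hne : q₁ ≠ q₂)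
    (hp8 : p % 8 = 7) (hq₁4 : q₁ % 4 = 3) (hq₂4 : q₂ % 4 = 3) (hM8 : ((q₁ : ℤ) * q₂) % 8 = 1)
    (hsplitp : ∀ ℓ ∈ S, (hℓ : ℓ.Prime) → ℓ ≠ 2 → haveI : Fact ℓ.Prime := ⟨hℓ⟩; legendreSym ℓ (-(p : ℤ)) = 1)
    (hsplitM : ∀ ℓ ∈ S, (hℓ : ℓ.Prime) → ℓ ≠ 2 → haveI : Fact ℓ.Prime := ⟨hℓ⟩; legendreSym ℓ ((q₁ : ℤ) * q₂) = 1)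
    (hδ₁ : qrBit q₁ ((e₁ - e₂) * (e₁ - e₃)) = 1) (hδ₂ : qrBit q₁ ((e₂ - e₁) * (e₂ - e₃)) = 1)
    {d : ℚ} (hd : d = -(p : ℚ) * ((q₁ : ℚ) * q₂)) [(E.quadraticTwist d).IsElliptic]
    {c : galH1Torsion (E.quadraticTwist d) 2} (hc : c ∈ selmerGroup (E.quadraticTwist d) 2) (a b : ℚˣ)
    (ha : kummerEquiv ℚ 2 ((E.quadraticTwist d).twoTorsionCharH1 (h.quadraticTwist d) c) =
      Additive.ofMul (QuotientGroup.mk a))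
    (hb : kummerEquiv ℚ 2 ((E.quadraticTwist d).twoTorsionCharH1 (h.quadraticTwist d).swap₁₂ c) =
      Additive.ofMul (QuotientGroup.mk b))
    (hpa : parityBit p (a : ℚ) = 0) (hpb : parityBit p (b : ℚ) = 0)
    (hα₁ : parityBit q₁ (a : ℚ) = 0) (hβ₁ : parityBit q₁ (b : ℚ) = 0)
    (hα₂ : parityBit q₂ (a : ℚ) = 0) (hβ₂ : parityBit q₂ (b : ℚ) = 0) : c = 0 := by
  -- the two kernels
  obtain ⟨ma, hma0, hmadiv, hmapos, ⟨hga, hmka⟩, -, hR2a, -, -, hPa⟩ :=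
    exists_intKernel_of_mem_selmerGroup_twist_triple E S h hS (fun ℓ hℓ hℓS => ⟨(hgood ℓ hℓ hℓS).1, (hgood ℓ hℓ hℓS).2.1⟩)
      hpS hq₁S hq₂S hpq₁ hpq₂ hne hp8 hq₁4 hq₂4 hM8 hsplitp hsplitM hd hc a ha hpa
  obtain ⟨mb, hmb0, hmbdiv, hmbpos, ⟨hgb, hmkb⟩, -, hR2b, -, -, hPb⟩ :=
    exists_intKernel_of_mem_selmerGroup_twist_triple E S h.swap₁₂ hS
      (fun ℓ hℓ hℓS => ⟨by rw [← neg_sub, padicValRat.neg]; exact (hgood ℓ hℓ hℓS).1, (hgood ℓ hℓ hℓS).2.2⟩)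
      hpS hq₁S hq₂S hpq₁ hpq₂ hne hp8 hq₁4 hq₂4 hM8 hsplitp hsplitM hd hc b hb hpb
  subst hd
  have h' := h.quadraticTwist (-(p : ℚ) * ((q₁ : ℚ) * q₂))
  obtain ⟨g12p, g13p, g23p⟩ := hgood p hp.out hpS
  obtain ⟨g12₁, g13₁, g23₁⟩ := hgood q₁ hq₁.out hq₁S
  -- `I₀*` at `p`: the `p`-residues vanish, hence the components are positive
  obtain ⟨hqa, hqb⟩ := E.qrBit_eq_zero_quadraticTwist_of_parityBit_eq_zero h (q := p)
    (padicValRat_negTriple_p hpq₁ hpq₂) g12p g13p g23p hc a b ha hb hpa hpb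
  rw [hqa, hα₁, hα₂, zero_mul, zero_mul, add_zero, add_zero] at hPa
  rw [hqb, hβ₁, hβ₂, zero_mul, zero_mul, add_zero, add_zero] at hPb
  have hapos : 0 < (a : ℚ) := by
    by_contra hna; rw [if_neg hna] at hR2a; rw [hR2a] at hPa; exact one_ne_zero hPa.symm
  have hbpos : 0 < (b : ℚ) := by
    by_contra hnb; rw [if_neg hnb] at hR2b; rw [hR2b] at hPb; exact one_ne_zero hPb.symm
  -- integer representatives
  have hmka' : (QuotientGroup.mk a : SqUnits ℚ) = QuotientGroup.mk (Units.mk0 (ma : ℚ) hma0) := by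
    rw [hmka]; congr 1
    exact Units.ext (by rw [Units.val_mk0, Units.val_mk0, hα₁, hα₂, if_neg zero_ne_one, if_neg zero_ne_one]; ring)
  have hmkb' : (QuotientGroup.mk b : SqUnits ℚ) = QuotientGroup.mk (Units.mk0 (mb : ℚ) hmb0) := by
    rw [hmkb]; congr 1
    exact Units.ext (by rw [Units.val_mk0, Units.val_mk0, hβ₁, hβ₂, if_neg zero_ne_one, if_neg zero_ne_one]; ring)
  -- the class `c` IS `c_{W''}(a, b)`
  have hceq : c = (E.quadraticTwist (-(p : ℚ) * ((q₁ : ℚ) * q₂))).twoDescentClass h' a b :=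
    (E.quadraticTwist (-(p : ℚ) * ((q₁ : ℚ) * q₂))).eq_twoDescentClass_of_kummerEquiv_eq h' a b ha hb
  -- the same-component class of `E` is Selmer
  have hcE : E.twoDescentClass h a b ∈ E.selmerGroup 2 := by
    rw [mem_selmerGroup_iff]
    refine ⟨fun v => ?_, fun w => ?_⟩
    · by_cases hvS : (primesEquiv v : ℕ) ∈ S
      · have hsq := isSquare_negTriple_adicCompletion S hpS hq₁S hq₂S hp8 hq₁4 hq₂4 hM8 hsplitp hsplitM v hvS
        have hloc : (E.quadraticTwist (-(p : ℚ) * ((q₁ : ℚ) * q₂))).twoDescentClass h' a b ∈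
            selmerLocalKer (E.quadraticTwist (-(p : ℚ) * ((q₁ : ℚ) * q₂))) (v.adicCompletion ℚ) 2 := by
          rw [← hceq]; exact ((mem_selmerGroup_iff _ _ _).mp hc).1 v
        exact (E.twoDescentClass_quadraticTwist_mem_selmerLocalKer_iff (v.adicCompletion ℚ)
          (charZero_of_injective_algebraMap (algebraMap ℚ _).injective) h hsq a b).mp hloc
      · have hℓ := (primesEquiv v).2
        have hℓ2 : (primesEquiv v : ℕ) ≠ 2 := fun h2 => hvS (h2 ▸ h2S)
        have hgoodv : E.HasGoodReductionAt v := by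
          by_contra hbad; exact hN _ hℓ hvS ((E.dvd_conductorNorm_iff v).mpr hbad)
        exact E.twoDescentClass_mem_selmerLocalKer_of_mk_eq_intCast h v hℓ2 hgoodv a b ma mb hma0 hmb0 hmka' hmkb'
          (hmadiv _ hℓ hvS) (hmbdiv _ hℓ hvS)
    · exact twoDescentClass_mem_selmerLocalKer_of_isSquare E h _
        (charZero_of_injective_algebraMap (algebraMap ℚ _).injective) a b
        (isSquare_algebraMap_completion_of_pos w hapos) (isSquare_algebraMap_completion_of_pos w hbpos)
  -- `I₀*` at `q₁`: the `q₁`-residues vanish, so the class of `E` is `0`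
  obtain ⟨hqa₁, hqb₁⟩ := E.qrBit_eq_zero_quadraticTwist_of_parityBit_eq_zero h (q := q₁)
    (padicValRat_negTriple_q₁ hpq₁ hne) g12₁ g13₁ g23₁ hc a b ha hb hα₁ hβ₁
  have hc0 : E.twoDescentClass h a b = 0 :=
    E.eq_zero_of_mem_selmerGroup_of_qrBit_eq_zero h hrank hsha (qrBit_neg_one_eq_one_of_emod_four hq₁4) hδ₁ hδ₂ hcE a b
      (E.kummerEquiv_twoTorsionCharH1_twoDescentClass h a b) (E.kummerEquiv_twoTorsionCharH1_swap_twoDescentClass h a b) hqa₁ hqb₁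
  -- so `[a] = [b] = 1` and `c = 0`
  have ha1 : (QuotientGroup.mk a : SqUnits ℚ) = QuotientGroup.mk 1 := by
    have := E.kummerEquiv_twoTorsionCharH1_twoDescentClass h a b
    rw [hc0, _root_.map_zero, _root_.map_zero] at this
    rw [QuotientGroup.mk_one]; exact Additive.ofMul.injective (this.symm.trans ofMul_one.symm)
  have hb1 : (QuotientGroup.mk b : SqUnits ℚ) = QuotientGroup.mk 1 := by
    have := E.kummerEquiv_twoTorsionCharH1_swap_twoDescentClass h a b
    rw [hc0, _root_.map_zero, _root_.map_zero] at this
    rw [QuotientGroup.mk_one]; exact Additive.ofMul.injective (this.symm.trans ofMul_one.symm)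
  refine (E.quadraticTwist (-(p : ℚ) * ((q₁ : ℚ) * q₂))).eq_of_kummerEquiv_twoTorsionCharH1_pair_eq h' 1 1
    (by rw [ha, ha1]) (by rw [hb, hb1]) ?_ ?_
  · rw [_root_.map_zero, _root_.map_zero, QuotientGroup.mk_one, ofMul_one]
  · rw [_root_.map_zero, _root_.map_zero, QuotientGroup.mk_one, ofMul_one]

end Unramified

end Summit.BirchSwinnertonDyer.BirchSwinnertonDyer.Theorems.GenusKolyvaginAtTwo.TorsionCellD0

end
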